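import Summits.BirchSwinnertonDyer.Rank1Residual.AdditivePotMult.VariableChangeSelmerOver
import Literature.NumberTheory.EllipticCurves.Kobayashi2003.SignedSelmer
import Literature.NumberTheory.EllipticCurves.PeriodIndexCorestrictionLocal
import HarnessLib

/-!
# Kobayashi's signed Selmer groups `Sel^±(E/K_∞)` are invariant under a change of Weierstrass
# model over `K` (η-descent frame of route `QuadraticBranchSignedControl`, rung K8, cell `bsd-potss`)

WHAT. For a change of variables `V • W₁ = W₂` over a number field `K`, a `ℤ_p`-extension `κ` of `K`
and a sign `ε`, the additive isomorphism `H¹(K_∞, E₁[p^∞]) ≃+ H¹(K_∞, E₂[p^∞])` of the tree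
(`AdditivePotMult.modelSubgroupH1Equiv`, the `h1Equiv` of the `Γ_K`-equivariant `primaryIso`) carries
Kobayashi's `Sel^ε(E₁/K_∞)` (`Kobayashi2003.signedSelmerInfty W₁ κ ε`, Def. 1.1: classical
conditions + the Kummer condition cut out by `E^ε(K_n·K_v)` at `v ∣ p`, direct limit over the
layers) EXACTLY onto `Sel^ε(E₂/K_∞)` (`map_modelSubgroupH1Equiv_signedSelmerInfty`), commuting with
every conjugation `σ_*`. Ingredients: the local isomorphism `E₁(K̄_v) ≃+ E₂(K̄_v)` (`twistLocalIso`,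
`Γ_{K_v}`-equivariant) preserves the layer points `E(K_n·K_v)`, the traces `Tr_{n/m}` and hence
`E^ε(K_n·K_v)` (§1); on explicit cocycles the Kummer condition is transported along the square
`pointsMap ∘ twistPointsIso = twistLocalIso ∘ pointsMap` (§2); `modelSubgroupH1Equiv` commutes with
restriction between layers (§3). Packaged (§4) as the existence of an additive isomorphism
`Sel^ε(E₂/K_∞) ≃+ Sel^ε(E₁/K_∞)` over `(modelSubgroupH1Equiv _).symm`, intertwining `conj_σ`.

WHY (cell `bsd-potss`, K8 η-package R102a). The ∀-form prime-to-`p` DESCENT FRAME — items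
19611 `EtaDescentFrame` ⊇ 19602 `EtaDescentFrameSurj` / 19607 `EtaDescentFrameNonsurj` — quantifies
over EVERY admissible quadratic model `V' = C • V_F`; seat k8q-c3's proved chain (19583
`EtaLayerComparison` ⟹ hMap ⟹ hSel) produces the frame for the literal base change `V_F`. This
file is the model-independence step `Sel⁺(V'/F_∞) ≃ Sel⁺(V_F/F_∞)` (Γ-equivariant).

HONEST FRAMING (cell `bsd-potss`, run/shared/lean/pub/bsd-potss/; FULL-BSD rank ≤ 1 programme):
TOOL THEOREMS ONLY (no definition, no named fact, no `sorry`, axioms standard), UNCONDITIONAL. Nothing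
about BSD is claimed; `BSD(W, p)` is claimed for no pair. Seat `bsd-potss-k8eta-c2` (prover), g0;
`--supports stmt-BirchSwinnertonDyer-19606` (crux `PlusEtaMainConjectureNonsurj`, whose glue consumes
the frame 19607).

References: [Kobayashi2003] S. Kobayashi, Invent. Math. 152 (2003), Def. 1.1 (p. 2), §2 (p. 4);
[SilvermanAEC2009] X.§4 (Selmer groups depend on `E/K`, not on the equation); [GreenbergLNM1716] §2.
-/

set_option autoImplicit false
set_option linter.dupNamespace false

noncomputable section

open scoped Classical

universe u

namespace Summit.BirchSwinnertonDyer.BirchSwinnertonDyer.Theorems.EtaFrame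

open Literature.NumberTheory.EllipticCurves Literature.NumberTheory.GaloisRepresentations
  WeierstrassCurve Summit.BirchSwinnertonDyer.Rank1Residual.AdditivePotMult
  Literature.NumberTheory.EllipticCurves.Kobayashi2003

/-! ## §1 Local: layer points, traces and `E^ε(K_n·K_v)` under `twistLocalIso` -/

section Local

variable {K : Type u} [Field K] {W₁ W₂ : WeierstrassCurve K} {V : VariableChange K}
  {p : ℕ} [Fact p.Prime] (κ : ZpExtension K p)
  {E : Type u} [Field E] [Algebra K E] (ι : AlgebraicClosure K →ₐ[K] AlgebraicClosure E)
  (hV : V • W₁ = W₂)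

/-- `E₁(K_n·K_v)` and `E₂(K_n·K_v)` correspond under the `Γ_{K_v}`-equivariant `twistLocalIso`
(fixed points of `Gal(K̄_v/K_n·K_v)`). [cite: Kobayashi2003, Def. 1.1] -/
theorem twistLocalIso_mem_localLayerPointsOfEmb_iff (n : ℕ) (P : localPoints W₁ E) :
    twistLocalIso E hV P ∈ localLayerPointsOfEmb κ ι W₂ n ↔ P ∈ localLayerPointsOfEmb κ ι W₁ n := by
  rw [mem_localLayerPointsOfEmb_iff, mem_localLayerPointsOfEmb_iff]
  refine forall_congr' fun τ => imp_congr_right fun _ => ?_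
  rw [← twistLocalIso_smul E hV, (twistLocalIso E hV).apply_eq_iff_eq]

/-- The traces `Tr_{n/m}` of `E₁` and `E₂` correspond under `twistLocalIso` (an additive
`Γ_{K_v}`-equivariant map commutes with `P ↦ ∑_q q̃ • P`). [cite: Kobayashi2003, Def. 1.1] -/
theorem twistLocalIso_localTraceOfEmb (m n : ℕ) (P : localPoints W₁ E) :
    twistLocalIso E hV (localTraceOfEmb κ ι W₁ m n P) =
      localTraceOfEmb κ ι W₂ m n (twistLocalIso E hV P) := by
  haveI : Fintype (localLayerSubgroupOfEmb κ ι m ⧸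
      (localLayerSubgroupOfEmb κ ι n).subgroupOf (localLayerSubgroupOfEmb κ ι m)) :=
    Fintype.ofFinite _
  rw [localTraceOfEmb_apply, localTraceOfEmb_apply, map_sum]
  exact Finset.sum_congr rfl fun q _ => twistLocalIso_smul E hV _ P

/-- **Kobayashi's `E^ε(K_n·K_v)` of `E₁` and of `E₂` correspond under `twistLocalIso`**
(Definition 1.1 is phrased in fixed points and traces). [cite: Kobayashi2003, Def. 1.1] -/
theorem twistLocalIso_mem_signedLocalPointsOfEmb_iff (ε : ℤˣ) (n : ℕ) (P : localPoints W₁ E) :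
    twistLocalIso E hV P ∈ signedLocalPointsOfEmb κ ι W₂ ε n ↔
      P ∈ signedLocalPointsOfEmb κ ι W₁ ε n := by
  rw [mem_signedLocalPointsOfEmb_iff, mem_signedLocalPointsOfEmb_iff,
    twistLocalIso_mem_localLayerPointsOfEmb_iff]
  refine and_congr Iff.rfl (forall_congr' fun m => forall_congr' fun _ => forall_congr' fun _ => ?_)
  rw [← twistLocalIso_localTraceOfEmb, twistLocalIso_mem_localLayerPointsOfEmb_iff]

/-- `E^ε(K_n·K_v)` of `E₂` is the image of that of `E₁` under `twistLocalIso`.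
[cite: Kobayashi2003, Def. 1.1] -/
theorem map_twistLocalIso_signedLocalPointsOfEmb (ε : ℤˣ) (n : ℕ) :
    (signedLocalPointsOfEmb κ ι W₁ ε n).map (twistLocalIso E hV).toAddMonoidHom =
      signedLocalPointsOfEmb κ ι W₂ ε n := by
  ext Q
  constructor
  · rintro ⟨P, hP, rfl⟩
    exact (twistLocalIso_mem_signedLocalPointsOfEmb_iff κ ι hV ε n P).mpr hP
  · intro hQ
    refine ⟨(twistLocalIso E hV).symm Q, ?_, (twistLocalIso E hV).apply_symm_apply Q⟩
    show (twistLocalIso E hV).symm Q ∈ signedLocalPointsOfEmb κ ι W₁ ε n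
    rw [← twistLocalIso_mem_signedLocalPointsOfEmb_iff κ ι hV, AddEquiv.apply_symm_apply]
    exact hQ

end Local

/-! ## §2 The Kummer condition under the change of model (explicit cocycles) -/

section Kummer

variable {K : Type u} [Field K] {W₁ W₂ : WeierstrassCurve K} {V : VariableChange K}
  (p : ℕ) (hV : V • W₁ = W₂) (H : Subgroup (Field.absoluteGaloisGroup K))
  (E : Type u) [Field E] [Algebra K E]

/-- On geometric points `primaryIso` is `twistPointsIso`. [folklore] -/
theorem coe_primaryIso (m : geomPrimaryTorsion W₁ p) :
    ((primaryIso p hV m : geomPrimaryTorsion W₂ p) : geomPoints W₂) = twistPointsIso hV m :=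
  coe_primaryComponentCongr _ _ _

/-- The local square for the inverses: `pointsMap ∘ twistPointsIso⁻¹ = twistLocalIso⁻¹ ∘ pointsMap`.
[cite: SilvermanAEC2009, X.§4] -/
theorem pointsMap_twistPointsIso_symm (P : geomPoints W₂) :
    pointsMap W₁ E ((twistPointsIso hV).symm P) = (twistLocalIso E hV).symm (pointsMap W₂ E P) := by
  apply (twistLocalIso E hV).injective
  rw [← pointsMap_twistPointsIso, AddEquiv.apply_symm_apply, AddEquiv.apply_symm_apply]

/-- **The Kummer condition is transported along the change of model, forward**: if
`c ∈ H¹(H, E₁[p^∞])` lies in the Kummer condition cut out by `A ≤ E₁(K̄_v)` (chosen embedding), then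
`modelSubgroupH1Equiv c` lies in the one cut out by `twistLocalIso(A) ≤ E₂(K̄_v)`: the witness
`(φ, Q, k)` becomes `(primaryIso ∘ φ, twistLocalIso Q, k)` by the local square.
[cite: Kobayashi2003, Def. 1.1] [cite: SilvermanAEC2009, X.§4] -/
theorem modelSubgroupH1Equiv_mem_localKummerOverOfEmb {A : AddSubgroup (localPoints W₁ E)}
    {c : W₁.subgroupH1 p H} (hc : c ∈ localKummerOverOfEmb W₁ p H (closureEmb (K := K) E) A) :
    modelSubgroupH1Equiv p hV H c ∈
      localKummerOverOfEmb W₂ p H (closureEmb (K := K) E) (A.map (twistLocalIso E hV).toAddMonoidHom) := by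
  obtain ⟨φ, Q, k, rfl, hA, hτ⟩ := hc
  refine ⟨contOneCocycles.pullback (ContinuousMonoidHom.id H)
      (resHomOfEquivariant (ContinuousMonoidHom.id H) (primaryIso p hV : geomPrimaryTorsion W₁ p →+ _)
        (primaryIso_smul_subgroup p hV H)) φ,
    twistLocalIso E hV Q, k, ?_, ?_, fun τ => ?_⟩
  · rw [modelSubgroupH1Equiv, h1Equiv_apply, resH1Hom_oneCocycleClass]
  · rw [← map_nsmul]
    exact ⟨(p ^ k) • Q, hA, rfl⟩
  · change pointsMap W₂ E ((primaryIso p hV (φ.1 (resGalSubgroupOfEmb H (closureEmb (K := K) E) τ)) :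
        geomPrimaryTorsion W₂ p) : geomPoints W₂) = _
    rw [coe_primaryIso, pointsMap_twistPointsIso]
    change twistLocalIso E hV (pointsMapOfEmb W₁ (closureEmb (K := K) E)
        ((φ.1 (resGalSubgroupOfEmb H (closureEmb (K := K) E) τ) : geomPrimaryTorsion W₁ p) :
          geomPoints W₁)) = _
    rw [hτ τ, map_sub, twistLocalIso_smul]

/-- **The Kummer condition is transported along the change of model, backward**: if
`modelSubgroupH1Equiv c` lies in the condition cut out by `twistLocalIso(A)`, then `c` lies in the
one cut out by `A` (pull the witness cocycle back along `primaryIso⁻¹`; injectivity of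
`modelSubgroupH1Equiv`). [cite: Kobayashi2003, Def. 1.1] [cite: SilvermanAEC2009, X.§4] -/
theorem mem_localKummerOverOfEmb_of_modelSubgroupH1Equiv_mem {A : AddSubgroup (localPoints W₁ E)}
    {c : W₁.subgroupH1 p H}
    (hc : modelSubgroupH1Equiv p hV H c ∈
      localKummerOverOfEmb W₂ p H (closureEmb (K := K) E) (A.map (twistLocalIso E hV).toAddMonoidHom)) :
    c ∈ localKummerOverOfEmb W₁ p H (closureEmb (K := K) E) A := by
  obtain ⟨φ₂, Q₂, k, hcl, hA, hτ⟩ := hc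
  -- the pulled-back witness
  have hsymm : ∀ (g : H) (m : geomPrimaryTorsion W₂ p),
      (primaryIso p hV).symm (g • m) = g • (primaryIso p hV).symm m :=
    symm_equivariant (primaryIso p hV) (primaryIso_smul_subgroup p hV H)
  let φ₁ : contOneCocycles (discreteTopRep H (W₁.geomPrimaryTorsion p)) :=
    contOneCocycles.pullback (ContinuousMonoidHom.id H)
      (resHomOfEquivariant (ContinuousMonoidHom.id H)
        ((primaryIso p hV).symm : geomPrimaryTorsion W₂ p →+ _) hsymm) φ₂
  have hpush : contOneCocycles.pullback (ContinuousMonoidHom.id H)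
      (resHomOfEquivariant (ContinuousMonoidHom.id H) (primaryIso p hV : geomPrimaryTorsion W₁ p →+ _)
        (primaryIso_smul_subgroup p hV H)) φ₁ = φ₂ := by
    apply Subtype.ext
    ext g : 1
    change primaryIso p hV ((primaryIso p hV).symm (φ₂.1 g)) = φ₂.1 g
    rw [AddEquiv.apply_symm_apply]
  have hc₁ : oneCocycleClass (discreteTopRep H (W₁.geomPrimaryTorsion p)) φ₁ = c := by
    apply (modelSubgroupH1Equiv p hV H).injective
    rw [modelSubgroupH1Equiv, h1Equiv_apply, resH1Hom_oneCocycleClass, hpush]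
    exact hcl
  obtain ⟨R, hR, hRQ⟩ := hA
  refine ⟨φ₁, (twistLocalIso E hV).symm Q₂, k, hc₁, ?_, fun τ => ?_⟩
  · rw [← map_nsmul, ← hRQ]
    change (twistLocalIso E hV).symm (twistLocalIso E hV R) ∈ A
    rw [AddEquiv.symm_apply_apply]
    exact hR
  · change pointsMap W₁ E (((primaryIso p hV).symm
        (φ₂.1 (resGalSubgroupOfEmb H (closureEmb (K := K) E) τ)) : geomPrimaryTorsion W₁ p) :
          geomPoints W₁) = _
    have hcoe : (((primaryIso p hV).symm (φ₂.1 (resGalSubgroupOfEmb H (closureEmb (K := K) E) τ)) :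
        geomPrimaryTorsion W₁ p) : geomPoints W₁) =
        (twistPointsIso hV).symm ((φ₂.1 (resGalSubgroupOfEmb H (closureEmb (K := K) E) τ) :
          geomPrimaryTorsion W₂ p) : geomPoints W₂) := by
      rw [AddEquiv.eq_symm_apply, ← coe_primaryIso p hV, AddEquiv.apply_symm_apply]
    rw [hcoe, pointsMap_twistPointsIso_symm]
    change (twistLocalIso E hV).symm (pointsMapOfEmb W₂ (closureEmb (K := K) E)
        ((φ₂.1 (resGalSubgroupOfEmb H (closureEmb (K := K) E) τ) : geomPrimaryTorsion W₂ p) :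
          geomPoints W₂)) = _
    rw [hτ τ, map_sub, symm_equivariant (twistLocalIso E hV) (twistLocalIso_smul E hV)]

/-- **The Kummer conditions of `E₁` and `E₂` correspond under the change of model** (iff).
[cite: Kobayashi2003, Def. 1.1] [cite: SilvermanAEC2009, X.§4] -/
theorem mem_localKummerOverOfEmb_iff_model (A : AddSubgroup (localPoints W₁ E))
    (c : W₁.subgroupH1 p H) :
    c ∈ localKummerOverOfEmb W₁ p H (closureEmb (K := K) E) A ↔
      modelSubgroupH1Equiv p hV H c ∈
        localKummerOverOfEmb W₂ p H (closureEmb (K := K) E) (A.map (twistLocalIso E hV).toAddMonoidHom) :=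
  ⟨modelSubgroupH1Equiv_mem_localKummerOverOfEmb p hV H E,
    mem_localKummerOverOfEmb_of_modelSubgroupH1Equiv_mem p hV H E⟩

end Kummer

/-! ## §3 `Sel^ε(E/K_n)` and `Sel^ε(E/K_∞)` under the change of model -/

section Selmer

variable {K : Type u} [Field K] [NumberField K] {W₁ W₂ : WeierstrassCurve K} {V : VariableChange K}
  (p : ℕ) [Fact p.Prime] (hV : V • W₁ = W₂) (κ : ZpExtension K p)

omit [NumberField K] [Fact p.Prime] in
/-- `modelSubgroupH1Equiv` commutes with restriction `res : H¹(H', ·) → H¹(H, ·)` (`H ≤ H'`): both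
composites are the map of the compatible pair `(H ↪ H', primaryIso)`. [folklore] -/
theorem modelSubgroupH1Equiv_resOfLe {H H' : Subgroup (Field.absoluteGaloisGroup K)} (h : H ≤ H')
    (c : W₁.subgroupH1 p H') :
    modelSubgroupH1Equiv p hV H (W₁.resOfLe p h c) = W₂.resOfLe p h (modelSubgroupH1Equiv p hV H' c) := by
  rw [modelSubgroupH1Equiv, modelSubgroupH1Equiv, h1Equiv_apply, h1Equiv_apply]
  change resH1Hom _ _ _ (resH1Hom _ _ _ c) = resH1Hom _ _ _ (resH1Hom _ _ _ c)
  rw [resH1Hom_resH1Hom, resH1Hom_resH1Hom]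
  exact congrFun (congrArg DFunLike.coe (resH1Hom_congr (by ext; rfl) (by ext; rfl) _ _)) c

/-- **`Sel^ε(E₁/K_n)` and `Sel^ε(E₂/K_n)` correspond under the change of model** (the classical
conditions by the tree's `mem_selmerGroupOver_iff_model`, the signed Kummer conditions at `v ∣ p` by
§2 with `twistLocalIso (E^ε(K_n·K_v)) = E^ε(K_n·K_v)` and `conj_σ`-compatibility).
[cite: Kobayashi2003, Def. 1.1] -/
theorem mem_signedSelmerLayer_iff_model (ε : ℤˣ) (n : ℕ) (c : W₁.subgroupH1 p (κ.layerSubgroup n)) :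
    c ∈ signedSelmerLayer W₁ κ ε n ↔
      modelSubgroupH1Equiv p hV (κ.layerSubgroup n) c ∈ signedSelmerLayer W₂ κ ε n := by
  rw [mem_signedSelmerLayer_iff, mem_signedSelmerLayer_iff]
  refine and_congr ?_ (forall_congr' fun v => forall_congr' fun _ => forall_congr' fun σ => ?_)
  · exact mem_selmerGroupOver_iff_model p hV (κ.layerSubgroup n) c
  · rw [← modelSubgroupH1Equiv_conjH1, mem_localKummerOverOfEmb_iff_model p hV,
      map_twistLocalIso_signedLocalPointsOfEmb]

/-- `Sel^ε(E₂/K_n)` is the image of `Sel^ε(E₁/K_n)`. [cite: Kobayashi2003, Def. 1.1] -/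
theorem map_modelSubgroupH1Equiv_signedSelmerLayer (ε : ℤˣ) (n : ℕ) :
    (signedSelmerLayer W₁ κ ε n).map (modelSubgroupH1Equiv p hV (κ.layerSubgroup n)).toAddMonoidHom =
      signedSelmerLayer W₂ κ ε n := by
  ext d
  constructor
  · rintro ⟨c, hc, rfl⟩
    exact (mem_signedSelmerLayer_iff_model p hV κ ε n c).mp hc
  · intro hd
    refine ⟨(modelSubgroupH1Equiv p hV (κ.layerSubgroup n)).symm d, ?_, AddEquiv.apply_symm_apply _ d⟩
    show (modelSubgroupH1Equiv p hV (κ.layerSubgroup n)).symm d ∈ signedSelmerLayer W₁ κ ε n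
    rw [mem_signedSelmerLayer_iff_model p hV κ ε n, AddEquiv.apply_symm_apply]
    exact hd

/-- **`Sel^ε(E₂/K_∞)` is the image of `Sel^ε(E₁/K_∞)` under `modelSubgroupH1Equiv`** (direct limit
over the layers; restriction commutes with the change of model). [cite: Kobayashi2003, Def. 1.1]
[cite: SilvermanAEC2009, X.§4] -/
theorem map_modelSubgroupH1Equiv_signedSelmerInfty (ε : ℤˣ) :
    (signedSelmerInfty W₁ κ ε).map (modelSubgroupH1Equiv p hV κ.kerSubgroup).toAddMonoidHom =
      signedSelmerInfty W₂ κ ε := by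
  rw [signedSelmerInfty, signedSelmerInfty, AddSubgroup.map_iSup]
  refine iSup_congr fun n => ?_
  rw [AddSubgroup.map_map, ← map_modelSubgroupH1Equiv_signedSelmerLayer p hV κ ε n, AddSubgroup.map_map]
  congr 1
  ext c
  exact modelSubgroupH1Equiv_resOfLe p hV (κ.kerSubgroup_le_layerSubgroup n) c

/-- Membership form: `c ∈ Sel^ε(E₁/K_∞) ↔ modelSubgroupH1Equiv c ∈ Sel^ε(E₂/K_∞)`.
[cite: Kobayashi2003, Def. 1.1] -/
theorem mem_signedSelmerInfty_iff_model (ε : ℤˣ) (c : W₁.subgroupH1 p κ.kerSubgroup) :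
    c ∈ signedSelmerInfty W₁ κ ε ↔ modelSubgroupH1Equiv p hV κ.kerSubgroup c ∈ signedSelmerInfty W₂ κ ε := by
  rw [← map_modelSubgroupH1Equiv_signedSelmerInfty p hV κ ε]
  constructor
  · exact fun hc => ⟨c, hc, rfl⟩
  · rintro ⟨c', hc', h⟩
    rwa [← (modelSubgroupH1Equiv p hV κ.kerSubgroup).injective h]

/-! ## §4 Package: a `conj`-intertwining isomorphism `Sel^ε(E₂/K_∞) ≃+ Sel^ε(E₁/K_∞)` -/

/-- **Kobayashi's `Sel^ε(E/K_∞)` does not depend on the Weierstrass model (up to a canonical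
`Γ_K`-equivariant isomorphism).** For `V • W₁ = W₂` there is an additive isomorphism
`Ψ : Sel^ε(E₂/K_∞) ≃+ Sel^ε(E₁/K_∞)` lying over `(modelSubgroupH1Equiv _)⁻¹` on `H¹(K_∞, ·)` and
intertwining the conjugation actions `conj_σ`, `σ ∈ Γ_K` (through which `Λ` acts). Existence form
(no definition is introduced). [cite: Kobayashi2003, Def. 1.1] [cite: SilvermanAEC2009, X.§4] -/
theorem exists_addEquiv_signedSelmerInfty_of_model (ε : ℤˣ) :
    ∃ Ψ : signedSelmerInfty W₂ κ ε ≃+ signedSelmerInfty W₁ κ ε,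
      (∀ s : signedSelmerInfty W₂ κ ε,
        ((Ψ s : signedSelmerInfty W₁ κ ε) : W₁.subgroupH1 p κ.kerSubgroup) =
          (modelSubgroupH1Equiv p hV κ.kerSubgroup).symm s) ∧
      ∀ (σ : Field.absoluteGaloisGroup K) (s : signedSelmerInfty W₂ κ ε),
        ((Ψ ⟨W₂.conjH1 p κ.kerSubgroup σ s, conjH1_mem_signedSelmerInfty W₂ κ ε σ s.2⟩ :
            signedSelmerInfty W₁ κ ε) : W₁.subgroupH1 p κ.kerSubgroup) =
          W₁.conjH1 p κ.kerSubgroup σ (Ψ s : W₁.subgroupH1 p κ.kerSubgroup) := by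
  set e := modelSubgroupH1Equiv p hV κ.kerSubgroup with he
  have hmem₁ : ∀ s : signedSelmerInfty W₂ κ ε, e.symm s ∈ signedSelmerInfty W₁ κ ε := fun s => by
    rw [mem_signedSelmerInfty_iff_model p hV κ ε, ← he, AddEquiv.apply_symm_apply]; exact s.2
  have hmem₂ : ∀ t : signedSelmerInfty W₁ κ ε, e t ∈ signedSelmerInfty W₂ κ ε := fun t =>
    (mem_signedSelmerInfty_iff_model p hV κ ε (t : W₁.subgroupH1 p κ.kerSubgroup)).mp t.2
  let Ψ : signedSelmerInfty W₂ κ ε ≃+ signedSelmerInfty W₁ κ ε :=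
    { toFun := fun s => ⟨e.symm s, hmem₁ s⟩
      invFun := fun t => ⟨e t, hmem₂ t⟩
      left_inv := fun s => Subtype.ext (e.apply_symm_apply _)
      right_inv := fun t => Subtype.ext (e.symm_apply_apply _)
      map_add' := fun s s' => Subtype.ext (map_add e.symm _ _) }
  refine ⟨Ψ, fun s => rfl, fun σ s => ?_⟩
  change e.symm (W₂.conjH1 p κ.kerSubgroup σ s) = W₁.conjH1 p κ.kerSubgroup σ (e.symm s)
  apply e.injective
  rw [AddEquiv.apply_symm_apply, he, modelSubgroupH1Equiv_conjH1, AddEquiv.apply_symm_apply]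

end Selmer

end Summit.BirchSwinnertonDyer.BirchSwinnertonDyer.Theorems.EtaFrame

end
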